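import Summits.Parity.GeneralizedHardyLittlewood.Theorems.BeyondDiagonalBeatsQuarter.OffDiagCoreLevelsTrunc
import HarnessLib

/-!
# Route `PrimeLevelFamEdge`, crux K_B (stmt-Parity-20343), line `diagonal_kernel_split` rev 4, plan Ω —
# L7d part 2, node D5a′ step 1 `OffDiagCoreLevelsTruncBox`: **one `(cell, h₁, q)` term of the `s`-tail of a switched piece,
# in COST form — with the level-free height `T(cell, h₁) = ⌈|h₁|·D₂(N)·(2N)^{ε₀}/(2π)⌉ + 2` the shifted-lattice tail at every
# level `q ∈ [N, 2N]` is `≤ 2^{k+1}·S₂(k; q)·(T−1)·q^{−kε₀}`**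

L7D-PLAN §3 D5a′. `OffDiagCoreLevelsTrunc.abs_coreTailS_le` bounds the `s`-tail of a piece by the nest sum of
`𝟙[h₁ unit]·‖c_{cell}(q)‖·Σ'_s 𝟙[T < |s + ab/(q(r+1))|]·‖Φ̂_q(h₁/(q(r+1)), s/h₁ + ab/(h₁q(r+1)))‖`; the inner series is the
object of `OffDiagShiftedLatticeTail.tsum_shifted_tail_norm_fourier2_boxWeight_le` (shift `τ·h₁ = ab/(q(r+1))`). This file fixes
the height and discharges that lemma's length condition uniformly in the level:

* `tailHeight ε₀ N r l m d₁ d₂ i h₁` (definition) `= ⌈|h₁|·D₂(N; cell)·(2N)^{ε₀}/(2π)⌉₊ + 2`, `D₂(q; cell)` the second-variable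
  derivative cost of the box weight at level `q`;
* `dCost_snd_antitone` — `D₂(q) ≤ D₂(N)` for `N ≤ q`; `tailHeight_length` — the length condition
  `|h₁|·D₂(q)/(2π)·q^{ε₀} ≤ T − 1` for `N ≤ q ≤ 2N`;
* **`inner_tail_le_cost`** — for `q, d₁, d₂, l/d₁, m/d₂ ≥ 1`, `h₁ ≠ 0`, `N ≤ q ≤ 2N`, `0 ≤ ε₀`, `k ≥ 2`:
  `Σ'_s 𝟙[T < |s + ab/(q(r+1))|]·‖Φ̂_q(…)‖ ≤ 2^{k+1}·S₂(k; cell, q)·(T−1)·((q^{ε₀})^k)⁻¹` at `T = tailHeight …`.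

Step 2 (`OffDiagCoreLevelsTruncCount`): monomials for `S₂`, `T − 1`, `‖c q‖` and the nest count ⇒ `coreTailS` is funded
(`OffDiagLargeConductorScales.funded_of_rpow_saving_ledger`, prover-8). Theorems + one definition; standard axioms. Helper toward
`stub_offDiagBelowSlack_io`; closes nothing.
«The programme SEARCHES and TYPES; no claim about Landau–Siegel zeros, Theorems 1–2 of arXiv:2211.02515 or
a repaired Margin232 until a kernel theorem says so.»
-/

noncomputable section

open Finset Real
open scoped FourierTransform Nat

namespace Summit.Parity.GeneralizedHardyLittlewood.Theorems.BeyondDiagonalBeatsQuarter.OffDiag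

open Literature.NumberTheory.LFunctions Literature.NumberTheory.LFunctions.KMV2000
open Literature.NumberTheory.Sieve.FriedlanderIwaniecPrimes (fourier2)
open Literature.Analysis.Calculus.WhitneyConvex (dyadicBumpBound dyadicBumpBound_nonneg)
open OffDiagPoissonTwisted (tsum_shifted_tail_norm_fourier2_boxWeight_le)

/-! ### §1. The second-variable cost and the level-free tail height -/

/-- The second-variable derivative cost `D₂(q; α, β, c, i) = (1 + 4π√(βα·2K₁)/(q c)·√(2K₂))/(K₂/2)` of the box weight
(prover-2's L2 shape). [folklore] -/
def dCostSnd (q α β c : ℕ) (i : ℕ × ℕ) : ℝ :=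
  (1 + 4 * π * Real.sqrt ((β : ℝ) * α * (2 * 2 ^ i.1)) / ((q : ℝ) * c) * Real.sqrt (2 * 2 ^ i.2)) / ((2 : ℝ) ^ i.2 / 2)

/-- `D₂ ≥ 0`. [folklore] -/
theorem dCostSnd_nonneg (q α β c : ℕ) (i : ℕ × ℕ) : 0 ≤ dCostSnd q α β c i := by
  unfold dCostSnd; positivity

/-- **`D₂` is antitone in the level**: `D₂(q) ≤ D₂(N)` for `1 ≤ N ≤ q` (`c ≥ 1`). [folklore] -/
theorem dCostSnd_antitone {q N : ℕ} (hN : 1 ≤ N) (hNq : N ≤ q) (α β : ℕ) {c : ℕ} (hc : 1 ≤ c) (i : ℕ × ℕ) :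
    dCostSnd q α β c i ≤ dCostSnd N α β c i := by
  unfold dCostSnd
  have hN0 : (0 : ℝ) < N := by exact_mod_cast hN
  have hc0 : (0 : ℝ) < c := by exact_mod_cast hc
  have hNq' : (N : ℝ) ≤ q := by exact_mod_cast hNq
  refine div_le_div_of_nonneg_right ?_ (by positivity)
  have hnum : 0 ≤ 4 * π * Real.sqrt ((β : ℝ) * α * (2 * 2 ^ i.1)) := by positivity
  have hs : 0 ≤ Real.sqrt (2 * 2 ^ i.2) := Real.sqrt_nonneg _
  have : 4 * π * Real.sqrt ((β : ℝ) * α * (2 * 2 ^ i.1)) / ((q : ℝ) * c) ≤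
      4 * π * Real.sqrt ((β : ℝ) * α * (2 * 2 ^ i.1)) / ((N : ℝ) * c) :=
    div_le_div_of_nonneg_left hnum (by positivity) (mul_le_mul_of_nonneg_right hNq' hc0.le)
  nlinarith [mul_le_mul_of_nonneg_right this hs]

/-- **The level-free tail height** of a cell and a dual modulus: `⌈|h₁|·D₂(N; cell)·(2N)^{ε₀}/(2π)⌉₊ + 2`.
[cite: KowalskiMichelVanderKam2000, Lemma 3.3 p. 9 — derivation] -/
def tailHeight (ε₀ : ℝ) (N : ℕ) (r l m d₁ d₂ : ℕ) (i : ℕ × ℕ) (h₁ : ℤ) : ℕ :=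
  ⌈|(h₁ : ℝ)| * dCostSnd N (l / d₁) (m / d₂) (r + 1) i / (2 * π) * (2 * (N : ℝ)) ^ ε₀⌉₊ + 2

/-- `tailHeight ≥ 2`. [folklore] -/
theorem two_le_tailHeight (ε₀ : ℝ) (N r l m d₁ d₂ : ℕ) (i : ℕ × ℕ) (h₁ : ℤ) :
    2 ≤ tailHeight ε₀ N r l m d₁ d₂ i h₁ := Nat.le_add_left 2 _

/-- **The length condition of the shifted-lattice tail, uniformly in the level**: for `1 ≤ N ≤ q ≤ 2N`, `0 ≤ ε₀`:
`|h₁|·D₂(q)/(2π)·q^{ε₀} ≤ tailHeight − 1`. [folklore] -/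
theorem tailHeight_length {ε₀ : ℝ} (hε₀ : 0 ≤ ε₀) {q N : ℕ} (hN : 1 ≤ N) (hNq : N ≤ q) (hq2 : q ≤ 2 * N)
    (r l m d₁ d₂ : ℕ) (i : ℕ × ℕ) (h₁ : ℤ) :
    |(h₁ : ℝ)| * dCostSnd q (l / d₁) (m / d₂) (r + 1) i / (2 * π) * (q : ℝ) ^ ε₀ ≤
      ((tailHeight ε₀ N r l m d₁ d₂ i h₁ - 1 : ℕ) : ℝ) := by
  have hq0 : (0 : ℝ) ≤ q := Nat.cast_nonneg _
  have hq2' : (q : ℝ) ≤ 2 * N := by exact_mod_cast hq2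
  have hD := dCostSnd_antitone hN hNq (l / d₁) (m / d₂) (Nat.succ_pos r) i
  have hD0 := dCostSnd_nonneg N (l / d₁) (m / d₂) (r + 1) i
  have hpow : (q : ℝ) ^ ε₀ ≤ (2 * (N : ℝ)) ^ ε₀ := Real.rpow_le_rpow hq0 hq2' hε₀
  have h1 : |(h₁ : ℝ)| * dCostSnd q (l / d₁) (m / d₂) (r + 1) i / (2 * π) * (q : ℝ) ^ ε₀ ≤
      |(h₁ : ℝ)| * dCostSnd N (l / d₁) (m / d₂) (r + 1) i / (2 * π) * (2 * (N : ℝ)) ^ ε₀ := by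
    have ha : 0 ≤ |(h₁ : ℝ)| := abs_nonneg _
    have : |(h₁ : ℝ)| * dCostSnd q (l / d₁) (m / d₂) (r + 1) i / (2 * π) ≤
        |(h₁ : ℝ)| * dCostSnd N (l / d₁) (m / d₂) (r + 1) i / (2 * π) :=
      div_le_div_of_nonneg_right (mul_le_mul_of_nonneg_left hD ha) (by positivity)
    exact mul_le_mul this hpow (by positivity) (by positivity)
  refine h1.trans ?_
  have hceil := Nat.le_ceil (|(h₁ : ℝ)| * dCostSnd N (l / d₁) (m / d₂) (r + 1) i / (2 * π) * (2 * (N : ℝ)) ^ ε₀)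
  refine hceil.trans ?_
  unfold tailHeight
  have : (⌈|(h₁ : ℝ)| * dCostSnd N (l / d₁) (m / d₂) (r + 1) i / (2 * π) * (2 * (N : ℝ)) ^ ε₀⌉₊ + 2 - 1 : ℕ) =
      ⌈|(h₁ : ℝ)| * dCostSnd N (l / d₁) (m / d₂) (r + 1) i / (2 * π) * (2 * (N : ℝ)) ^ ε₀⌉₊ + 1 := by omega
  rw [this]
  push_cast
  linarith

/-! ### §2. One `(cell, h₁, q)` term of the tail in cost form -/

/-- **The inner shifted-lattice tail at the level-free height, in prover-2's cost form.** For `q, d₁, d₂, l/d₁, m/d₂ ≥ 1`,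
`h₁ ≠ 0`, `1 ≤ N ≤ q ≤ 2N`, `0 ≤ ε₀`, `k ≥ 2`, `T = tailHeight ε₀ N r l m d₁ d₂ i h₁`:
`Σ'_s 𝟙[T < |s + ab/(q(r+1))|]·‖Φ̂_q(h₁/(q(r+1)), s/h₁ + ab/(h₁q(r+1)))‖ ≤ 2^{k+1}·S₂(k)·(T−1)·((q^{ε₀})^k)⁻¹`.
[cite: KowalskiMichelVanderKam2000, Lemma 3.3 p. 9 — derivation] -/
theorem inner_tail_le_cost {q : ℕ} [NeZero q] {N : ℕ} (hN : 1 ≤ N) (hNq : N ≤ q) (hq2 : q ≤ 2 * N)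
    {r l m d₁ d₂ : ℕ} (hd₁ : 1 ≤ d₁) (hd₂ : 1 ≤ d₂) (ha : 1 ≤ l / d₁) (hb : 1 ≤ m / d₂) (i : ℕ × ℕ)
    {h₁ : ℤ} (hh₁ : h₁ ≠ 0) {ε₀ : ℝ} (hε₀ : 0 ≤ ε₀) {k : ℕ} (hk : 2 ≤ k) :
    ∑' s : ℤ, (if (tailHeight ε₀ N r l m d₁ d₂ i h₁ : ℝ) <
        |(s : ℝ) + ((((l / d₁ : ℕ) : ℤ) * (m / d₂ : ℕ) : ℤ) : ℝ) / ((q * (r + 1) : ℕ) : ℝ)| then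
      ‖fourier2 (boxWeight q d₁ d₂ (l / d₁) (m / d₂) (r + 1) i) (h₁ / (q * (r + 1) : ℕ))
        ((s : ℝ) / h₁ + (((l / d₁ : ℕ) : ℤ) * (m / d₂ : ℕ) : ℝ) / ((h₁ : ℝ) * (q * (r + 1) : ℕ)))‖ else 0) ≤
      2 ^ (k + 1) * ((3 * 2 ^ i.1 / 2) * (3 * 2 ^ i.2 / 2) *
        (∑ j ∈ Finset.range (k + 1), (k.choose j : ℝ) * (2 ^ j * dyadicBumpBound j) *
          ((((k - j : ℕ) : ℝ) + 1) ^ 2 * (k - j) ! * ((k - j : ℕ) : ℝ) ^ (k - j))) *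
        (((d₂ : ℝ) * d₁ * (2 ^ i.1 / 2)) ^ (-(1 : ℝ) / 2) * ((r + 1 : ℕ) : ℝ)⁻¹ * ((2 : ℝ) ^ i.2 / 2) ^ (-(1 : ℝ) / 2))) *
        ((tailHeight ε₀ N r l m d₁ d₂ i h₁ - 1 : ℕ) : ℝ) * (((q : ℝ) ^ ε₀) ^ k)⁻¹ := by
  have hq1 : (1 : ℝ) ≤ q := by exact_mod_cast le_trans hN hNq
  have hQ1 : (1 : ℝ) ≤ (q : ℝ) ^ ε₀ := Real.one_le_rpow hq1 hε₀
  have hh' : (h₁ : ℝ) ≠ 0 := by exact_mod_cast hh₁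
  have hC0 : (0 : ℝ) < ((q * (r + 1) : ℕ) : ℝ) := by
    have : 0 < q * (r + 1) := Nat.mul_pos (by omega) (Nat.succ_pos r); exact_mod_cast this
  -- the shift: `τ·h₁ = ab/(q(r+1))` with `τ = ab/(h₁ q(r+1))`
  have hnum : ((((l / d₁ : ℕ) : ℤ) * (m / d₂ : ℕ) : ℤ) : ℝ) = (((l / d₁ : ℕ) : ℤ) * (m / d₂ : ℕ) : ℝ) := by
    simp only [Int.cast_mul, Int.cast_natCast]
  have hshift : ∀ s : ℤ, (s : ℝ) + ((((l / d₁ : ℕ) : ℤ) * (m / d₂ : ℕ) : ℤ) : ℝ) / ((q * (r + 1) : ℕ) : ℝ) =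
      (s : ℝ) + ((((l / d₁ : ℕ) : ℤ) * (m / d₂ : ℕ) : ℝ) / ((h₁ : ℝ) * (q * (r + 1) : ℕ))) * h₁ := by
    intro s
    rw [hnum]
    field_simp
  have hlen := tailHeight_length hε₀ hN hNq hq2 r l m d₁ d₂ i h₁
  have hmain := tsum_shifted_tail_norm_fourier2_boxWeight_le (q := q) (r := r + 1) hd₁ hd₂ ha hb i hh₁
    ((((l / d₁ : ℕ) : ℤ) * (m / d₂ : ℕ) : ℝ) / ((h₁ : ℝ) * (q * (r + 1) : ℕ))) ((h₁ : ℝ) / (q * (r + 1) : ℕ))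
    hk (two_le_tailHeight ε₀ N r l m d₁ d₂ i h₁) hQ1 (by
      unfold dCostSnd at hlen
      push_cast at hlen ⊢
      exact hlen)
  refine le_of_eq_of_le (tsum_congr fun s ↦ ?_) hmain
  rw [hshift s]

end Summit.Parity.GeneralizedHardyLittlewood.Theorems.BeyondDiagonalBeatsQuarter.OffDiag
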